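import Summits.QuantumFields.BalabanUV.T4Continuum.Support.ShellMeasureDecayComplexRayFirstOrder
import Summits.QuantumFields.BalabanUV.Beta.MultiscaleDecayDirichlet

/-!
# `T4Continuum.ShellMeasureDecayComplexRayDirichlet` — ROW S121 (J6) file 3: THE SECTIONED OPERATOR ALONG THE COMPLEX RAY — the Dirichlet
# sandwich `Ω₀·levelOp·Ω₀ + (1 − Ω₀)` of `Beta/MultiscaleDecayDirichlet` plus a re-nonnegative complex remainder keeps the k-uniform decay
# with local prefactors, for EVERY domain `Ω₀ = {χ = 1}`; cutting a remainder by `Ω₀` keeps accretivity, the bond support and the entry budget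
(cell `pub-balaban`, sub-cell `t4`, spine estimate NE7c (node U5b); NE7c ROUND-2 crew `t4-ne7c-formalise-*`, unit
`b2b-balaban-t4-ne7c-formalise-leaf-10` gen 15; owner table `t4/b2b-balaban-t4-ne7c-p1/LEAVES-NE7c-P1.md` ROW **S121 = J6** (GO R-ne7cp1-g37-10 (b)),
file 3 over file 2 `ShellMeasureDecayComplexRayFirstOrder` and `Beta/MultiscaleDecayDirichlet` (`hc_sandwich`); ADDITIVE — imports those two ONLY;
[folklore]; theorems only, 0 `def`, 0 `def … : Prop`, 0 sorry, 0 citation tags; touches NO host; moves NO census row)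

HONEST FRAMING.  Finite four-torus programme, rung (B)+1 only — NOT infinite volume, NOT a mass gap, NOT the Clay problem, NOT summit
progress; (B), `BetaPertHyp`, (B^μ) not consumed.  NE7c (`T4IndicatorShell.ShellWeightBound` for the cell's expansions) is NOT PRINTED in
[Balaban 1983–89] and NOT PROVED; «NE7c ⇐ the named binders» (trigger c3).  This file composes OUR `Beta/` library's Dirichlet-sandwich
coercivity (`MultiscaleDecayDirichlet.hc_sandwich`, beta-d4-p2) with file 1's re-nonnegative-remainder clause and file 2's bond budget, all BY
NAME, for OUR torus MODEL; the domain `χ`, the remainder `P`, its accretivity and its budget are DISPLAYED data ∕ hypotheses; nothing of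
Bałaban's is asserted, cited or discharged — which localized, complexified operator of [Balaban1985Variational] the u-tuple's `𝒢` IS stays
node O ∕ ROW S116 (J1); the (α4) «sectioning» reading is ROW S118 (J3)'s.  HONEST DEPENDENCY (cell): continuum YM on T⁴ ⇐ BetaPertH ∧ nine
spine estimates (0/9 proved); BetaPertH ⇐ (D1) ∧ (D4) ∧ CAP+tail; G-an2-4 gates asym, D1 and NE2/3/4.

THE POINT.  The u-tuple's propagators are SECTIONED (block variables live, exterior frozen: [B9]'s `Ω₀Δ′_aΩ₀`, the `dirInv` currency of
`Beta/MultiscaleDecayDirichlet` and of ROW S118∕J3 file 2) AND complexified along the contraction ray (file 1∕2).  Both devices compose: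
* §1 CUTTING A REMAINDER BY THE DOMAIN — for `χ ∈ {0,1}` (more generally `|χ| ≤ 1`) the cut kernel `χ(e)·P(e,e′)·χ(e′)` is re-nonnegative if
  `P` is (`re_nonneg_cut`), its exponential row∕column defects do not exceed `P`'s (`expRowDefect_cut_le`, `expColDefect_cut_le`), its support
  is inside `P`'s and its entries are bounded by `P`'s (`cut_supp`, `norm_cut_le`) — so every hypothesis of files 1–2 passes to the cut remainder.
* §2 **`decay_sandwich_add_complexRay`** — `MultiscaleDecayDirichlet.decay_dirInv_levelOp`'s binders (… `χ hχ`) + `P hP θ hθ hJ` with the profile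
  `min(μ₀, 1)·n⁻²` ⟹ `cmat (Ω₀·levelOp·Ω₀ + (1 − Ω₀)) + P` is a unit and its inverse's entries are
  `≤ e^{−κ·d_n(p,q)}·n(p)n(q)∕((1 − θ)·min(μ₀,1))` — EVERY domain, the same local prefactors (`hc_sandwich` → `realConjForm_toMatrix'` +
  `localConjCoercive_of_real` → file 1's `norm_inv_add_le_local_of_re_nonneg`).
* §3 **`decay_sandwich_add_firstOrder`** — the same with file 2's ENTRYWISE first-order hypothesis (`P` on diagonal ∪ fine bonds,
  `‖P((x,i),(y,i′))‖ ≤ β·slen_n(x,y)`) and the level-free smallness `4d·|Cp|·β·κ < min(μ₀,1)`: denominator `min(μ₀,1) − 4d|Cp|βκ`.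
NOT claimed: the entry cut `χ(p)χ(q)` of `dirInv` proper (|χ| ≤ 1 only improves the bound — one line for the consumer); sup members; any bound on
Bałaban's remainder.
-/

noncomputable section

open scoped BigOperators Matrix ComplexConjugate
open Finset Function Complex Matrix

namespace Summit.QuantumFields.BalabanUV.T4Continuum.ShellMeasureDecayComplexRayDirichlet

open Summit.QuantumFields.BalabanUV.Beta
open Summit.QuantumFields.BalabanUV.Beta.BoxPoincare (Box)
open Summit.QuantumFields.BalabanUV.Beta.MultiscaleCoerciveTorus
open Summit.QuantumFields.BalabanUV.Beta.MultiscaleDecayBudget (siteScale one_le_siteScale)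
open Summit.QuantumFields.BalabanUV.Beta.MultiscaleDistance (bondGraph slen sdist sdist_self)
open Summit.QuantumFields.BalabanUV.Beta.MultiscaleDecayDirichlet (hc_sandwich)
open Summit.QuantumFields.BalabanUV.Beta.AccretiveCombesThomas (conjForm star_dotProduct_mulVec_eq)
open Summit.QuantumFields.BalabanUV.Beta.AccretiveCombesThomasBudget (expWeight expWeight_nonneg expRowDefect expColDefect)
open Summit.QuantumFields.BalabanUV.Beta.MultiscaleCombesThomasBudget (localConjCoercive_of_real realConjForm realConjForm_toMatrix')
open Summit.QuantumFields.BalabanUV.Beta.CovariantTowerMatrix (cmat)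
open Summit.QuantumFields.BalabanUV.T4Continuum.ShellMeasureDecayComplexRay (norm_inv_add_le_local_of_re_nonneg)
open Summit.QuantumFields.BalabanUV.T4Continuum.ShellMeasureDecayComplexRayFirstOrder (expRowDefect_le_of_bondBudget
  expColDefect_le_of_bondBudget card_adj_le_two_mul)
open Literature.MathematicalPhysics.QuantumFieldTheory.Balaban1983to89
open Literature.MathematicalPhysics.QuantumFieldTheory.Balaban1983to89.B9Thm37Sum (mulOp)
open Literature.MathematicalPhysics.QuantumFieldTheory.Balaban1983to89.B9Thm37GluePU (bsrc btgt)
open Literature.MathematicalPhysics.QuantumFieldTheory.Balaban1983to89.B9Thm37GlueTorusCov (tblk)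
open Literature.MathematicalPhysics.QuantumFieldTheory.Balaban1983to89.B9Thm37GlueTorusCovLevels (levelOp)
open B5TorusCover (UT Ctr ctrU)

/-! ## §1 Cutting a remainder by the domain keeps every hypothesis -/

section Cut

variable {ι : Type*} [Fintype ι]

omit [Fintype ι] in
/-- Entries of the cut kernel are bounded by the original ones when `|χ| ≤ 1`. [folklore] -/
theorem norm_cut_le (P : Matrix ι ι ℂ) (χ : ι → ℝ) (hχ : ∀ e, |χ e| ≤ 1) (e e' : ι) :
    ‖((χ e : ℂ) * P e e' * (χ e' : ℂ))‖ ≤ ‖P e e'‖ := by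
  rw [norm_mul, norm_mul, Complex.norm_real, Complex.norm_real, Real.norm_eq_abs, Real.norm_eq_abs]
  calc |χ e| * ‖P e e'‖ * |χ e'| ≤ 1 * ‖P e e'‖ * 1 :=
        mul_le_mul (mul_le_mul_of_nonneg_right (hχ e) (norm_nonneg _)) (hχ e') (abs_nonneg _)
          (mul_nonneg zero_le_one (norm_nonneg _))
    _ = ‖P e e'‖ := by ring

omit [Fintype ι] in
/-- The cut kernel vanishes where the original does. [folklore] -/
theorem cut_supp (P : Matrix ι ι ℂ) (χ : ι → ℝ) {e e' : ι} (h : (χ e : ℂ) * P e e' * (χ e' : ℂ) ≠ 0) : P e e' ≠ 0 := by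
  intro h0
  exact h (by rw [h0, mul_zero, zero_mul])

/-- **Cutting keeps accretivity**: `Re z^*(χPχ)z = Re (χz)^*P(χz) ≥ 0`. [folklore] -/
theorem re_nonneg_cut (P : Matrix ι ι ℂ) (hP : ∀ z : ι → ℂ, 0 ≤ (star z ⬝ᵥ (P *ᵥ z)).re) (χ : ι → ℝ) (z : ι → ℂ) :
    0 ≤ (star z ⬝ᵥ ((Matrix.of fun e e' => (χ e : ℂ) * P e e' * (χ e' : ℂ)) *ᵥ z)).re := by
  have h := hP (fun e => (χ e : ℂ) * z e)
  rw [star_dotProduct_mulVec_eq] at h ⊢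
  convert h using 2
  refine Finset.sum_congr rfl fun e _ => Finset.sum_congr rfl fun e' _ => ?_
  simp only [Matrix.of_apply, map_mul, Complex.conj_ofReal]
  ring

/-- **Cutting does not increase the exponential ROW defect** (`|χ| ≤ 1`). [folklore] -/
theorem expRowDefect_cut_le (P : Matrix ι ι ℂ) (χ : ι → ℝ) (hχ : ∀ e, |χ e| ≤ 1) (κ : ℝ) (ρ : ι → ℝ) (e : ι) :
    expRowDefect (Matrix.of fun e e' => (χ e : ℂ) * P e e' * (χ e' : ℂ)) κ ρ e ≤ expRowDefect P κ ρ e := by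
  unfold expRowDefect
  exact Finset.sum_le_sum fun e' _ => by
    rw [Matrix.of_apply]
    exact mul_le_mul_of_nonneg_right (norm_cut_le P χ hχ e e') (expWeight_nonneg κ ρ e e')

/-- **Cutting does not increase the exponential COLUMN defect** (`|χ| ≤ 1`). [folklore] -/
theorem expColDefect_cut_le (P : Matrix ι ι ℂ) (χ : ι → ℝ) (hχ : ∀ e, |χ e| ≤ 1) (κ : ℝ) (ρ : ι → ℝ) (e' : ι) :
    expColDefect (Matrix.of fun e e' => (χ e : ℂ) * P e e' * (χ e' : ℂ)) κ ρ e' ≤ expColDefect P κ ρ e' := by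
  unfold expColDefect
  exact Finset.sum_le_sum fun e _ => by
    rw [Matrix.of_apply]
    exact mul_le_mul_of_nonneg_right (norm_cut_le P χ hχ e e') (expWeight_nonneg κ ρ e e')

omit [Fintype ι] in
/-- A `{0,1}`-valued function has `|χ| ≤ 1`. [folklore] -/
theorem abs_le_one_of_zero_or_one {χ : ι → ℝ} (hχ : ∀ e, χ e = 0 ∨ χ e = 1) (e : ι) : |χ e| ≤ 1 := by
  rcases hχ e with h | h <;> simp [h]

end Cut

/-! ## §2 The Dirichlet sandwich along the complex ray: every domain, the same local prefactors -/

section Sandwich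

variable {d : ℕ} {N : Fin d → ℕ} [∀ i, NeZero (N i)] [NeZero d] {Cp J K : Type} [Fintype Cp] [DecidableEq Cp] [Fintype J] [Fintype K]
  (S : J → ℕ) (hS : ∀ l, 1 ≤ S l) (hdivS : ∀ l i, S l ∣ N i) (lvl : K → J) (zc : (k : K) → Ctr N (S (lvl k)))

/-- **THE SECTIONED OPERATOR ALONG THE COMPLEX RAY (MODEL; every domain).**  Setting of `MultiscaleDecayDirichlet.decay_dirInv_levelOp`
(torus, covering disjoint cube family, isometric `Rm`, `T`, print-size weights from above, `|c| ≤ c_max`, cell-sum coercivity `C`, `0 ≤ κ ≤ 1`,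
`μ₀ > 0`, a `{0,1}`-valued `χ`) + a complex remainder `P` with `Re z^*Pz ≥ 0` and the sitewise budget
`½(expRowDefect + expColDefect)(P; κ, d_n(·,q₁))(e) ≤ θ·min(μ₀,1)·n(e₁)⁻²`, `θ < 1`.  Then the complexified sandwich
`cmat (Ω₀·levelOp·Ω₀ + (1 − Ω₀)) + P` is a unit and `‖(…)⁻¹(p,q)‖ ≤ e^{−κ·d_n(p,q)}·n(p)n(q)∕((1 − θ)·min(μ₀,1))`. [folklore] -/
theorem decay_sandwich_add_complexRay
    (hdisj : ∀ k k' v v', cellPt S hS hdivS lvl zc k v = cellPt S hS hdivS lvl zc k' v' → k = k')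
    (hcover : ∀ x : UT N, ∃ k, ∃ v : Box d (S (lvl k)), cellPt S hS hdivS lvl zc k v = x)
    (Rm : UT N × Fin d → Cp → Cp → ℝ) (hRm : ∀ b i j, ∑ k, Rm b k i * Rm b k j = if i = j then (1 : ℝ) else 0)
    (T : J → UT N → Cp → Cp → ℝ) (hT : ∀ l x i i', ∑ k, T l x k i * T l x k i' = if i = i' then (1 : ℝ) else 0)
    (a : J → ℝ) (ha : ∀ j, 0 ≤ a j) (ω : J → UT N → ℝ)
    (hsupp : ∀ l x, ω l (ctrU N (S l) (tblk (hS l) (hdivS l) x)) ≠ 0 → ∃ k v, lvl k = l ∧ cellPt S hS hdivS lvl zc k v = x)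
    {amax : ℝ} (hamax : 0 ≤ amax)
    (hscale : ∀ k, a (lvl k) * ω (lvl k) (ctrU N (S (lvl k)) (zc k)) ^ 2 * (S (lvl k) : ℝ) ^ d ≤ amax / (S (lvl k) : ℝ) ^ 2)
    (c : UT N × Fin d → ℝ) {cmax : ℝ} (hc : ∀ b, |c b| ≤ cmax) {C : ℝ}
    (hcoer : ∀ f : UT N × Cp → ℝ,
      C * ∑ k, ((S (lvl k) : ℝ) ^ 2)⁻¹ * ∑ v : Box d (S (lvl k)), ∑ i, f (cellPt S hS hdivS lvl zc k v, i) ^ 2 ≤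
        ∑ p, f p * levelOp bsrc btgt c Rm (fun l x => ctrU N (S l) (tblk (hS l) (hdivS l) x))
          (fun l x => ω l (ctrU N (S l) (tblk (hS l) (hdivS l) x))) T a f p)
    {κ : ℝ} (hκ0 : 0 ≤ κ) (hκ1 : κ ≤ 1) (hμ : 0 < C - 2 * d * cmax ^ 2 * κ ^ 2 - amax * (Real.exp (2 * d * κ) - 1))
    (χ : UT N × Cp → ℝ) (hχ : ∀ p, χ p = 0 ∨ χ p = 1)
    (P : Matrix (UT N × Cp) (UT N × Cp) ℂ) (hP : ∀ z, 0 ≤ (star z ⬝ᵥ (P *ᵥ z)).re) {θ : ℝ} (hθ : θ < 1)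
    (hJ : ∀ q e : UT N × Cp,
      (expRowDefect P κ (fun e => sdist bsrc btgt (siteScale S hS hdivS lvl zc hcover) e.1 q.1) e +
          expColDefect P κ (fun e => sdist bsrc btgt (siteScale S hS hdivS lvl zc hcover) e.1 q.1) e) / 2 ≤
        θ * (min (C - 2 * d * cmax ^ 2 * κ ^ 2 - amax * (Real.exp (2 * d * κ) - 1)) 1 *
          ((siteScale S hS hdivS lvl zc hcover e.1 : ℝ) ^ 2)⁻¹))
    (p q : UT N × Cp) :
    IsUnit (cmat (mulOp χ * levelOp bsrc btgt c Rm (fun l x => ctrU N (S l) (tblk (hS l) (hdivS l) x))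
          (fun l x => ω l (ctrU N (S l) (tblk (hS l) (hdivS l) x))) T a * mulOp χ + mulOp (1 - χ) :
        Module.End ℝ (UT N × Cp → ℝ)) + P) ∧
      ‖(cmat (mulOp χ * levelOp bsrc btgt c Rm (fun l x => ctrU N (S l) (tblk (hS l) (hdivS l) x))
            (fun l x => ω l (ctrU N (S l) (tblk (hS l) (hdivS l) x))) T a * mulOp χ + mulOp (1 - χ) :
          Module.End ℝ (UT N × Cp → ℝ)) + P)⁻¹ p q‖ ≤
        Real.exp (-(κ * sdist bsrc btgt (siteScale S hS hdivS lvl zc hcover) p.1 q.1)) *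
          ((siteScale S hS hdivS lvl zc hcover p.1 : ℝ) * (siteScale S hS hdivS lvl zc hcover q.1 : ℝ)) /
          ((1 - θ) * min (C - 2 * d * cmax ^ 2 * κ ^ 2 - amax * (Real.exp (2 * d * κ) - 1)) 1) := by
  classical
  set n := siteScale S hS hdivS lvl zc hcover with hn
  set Sw := (mulOp χ * levelOp bsrc btgt c Rm (fun l x => ctrU N (S l) (tblk (hS l) (hdivS l) x))
      (fun l x => ω l (ctrU N (S l) (tblk (hS l) (hdivS l) x))) T a * mulOp χ + mulOp (1 - χ) :
    Module.End ℝ (UT N × Cp → ℝ)) with hSw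
  set m₀ := min (C - 2 * d * cmax ^ 2 * κ ^ 2 - amax * (Real.exp (2 * d * κ) - 1)) 1 with hm₀
  have hm : 0 < m₀ := lt_min hμ zero_lt_one
  have hn0 : ∀ x, (0 : ℝ) < n x := fun x => by exact_mod_cast one_le_siteScale S hS hdivS lvl zc hcover x
  set μ : UT N × Cp → ℝ := fun e => m₀ * ((n e.1 : ℝ) ^ 2)⁻¹ with hμdef
  have hμpos : ∀ e, 0 < μ e := fun e => mul_pos hm (inv_pos.mpr (pow_pos (hn0 e.1) 2))
  set dd : UT N × Cp → UT N × Cp → ℝ := fun e e' => sdist bsrc btgt n e.1 e'.1 with hdd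
  have hd0 : ∀ j, dd j j = 0 := fun j => sdist_self bsrc btgt n j.1
  have hcR : ∀ j, ∀ w : UT N × Cp → ℝ, ∑ e, μ e * w e ^ 2 ≤ realConjForm (LinearMap.toMatrix' Sw) κ (fun e => dd e j) w := by
    intro j w
    rw [realConjForm_toMatrix']
    have h := hc_sandwich S hS hdivS lvl zc hdisj hcover Rm hRm T hT a ha ω hsupp hamax hscale c hc hcoer hκ0 hκ1 χ hχ j w
    refine le_trans (le_of_eq (Finset.sum_congr rfl fun e _ => ?_)) h
    rw [hμdef]
  have hcA : ∀ j, ∀ z : UT N × Cp → ℂ, ∑ e, μ e * ‖z e‖ ^ 2 ≤ (conjForm (cmat Sw) κ (fun e => dd e j) z).re :=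
    fun j z => localConjCoercive_of_real _ (hcR j) z
  have hEND := norm_inv_add_le_local_of_re_nonneg (cmat Sw) P dd hd0 hκ0 hμpos hθ hcA hP (fun j e => hJ j e) p q
  refine ⟨hEND.1, ?_⟩
  have hsqrt : Real.sqrt (μ p * μ q) = m₀ / ((n p.1 : ℝ) * (n q.1 : ℝ)) := by
    have hp := hn0 p.1
    have hq := hn0 q.1
    have e : μ p * μ q = (m₀ / ((n p.1 : ℝ) * (n q.1 : ℝ))) ^ 2 := by
      rw [hμdef]
      field_simp
    rw [e, Real.sqrt_sq (div_nonneg hm.le (mul_nonneg hp.le hq.le))]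
  have h2 := hEND.2
  rw [hsqrt] at h2
  have h1θ : 0 < 1 - θ := by linarith
  have hpq : 0 < (n p.1 : ℝ) * (n q.1 : ℝ) := mul_pos (hn0 p.1) (hn0 q.1)
  calc ‖(cmat Sw + P)⁻¹ p q‖ ≤ Real.exp (-(κ * dd p q)) / ((1 - θ) * (m₀ / ((n p.1 : ℝ) * (n q.1 : ℝ)))) := h2
    _ = Real.exp (-(κ * dd p q)) * ((n p.1 : ℝ) * (n q.1 : ℝ)) / ((1 - θ) * m₀) := by
        field_simp

/-! ## §3 The sectioned operator with a FIRST-ORDER remainder: `min(μ₀,1) − 4d·|Cp|·β·κ` -/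

/-- **THE SECTIONED OPERATOR WITH A FIRST-ORDER REMAINDER (MODEL; every domain).**  As §2, with file 2's entrywise hypothesis: `P` supported on
the diagonal and on the fine bonds, `‖P((x,i),(y,i′))‖ ≤ β·slen_n(x,y)` (`β ≥ 0`), and the level-free smallness `4d·|Cp|·β·κ < min(μ₀,1)`:
`‖(cmat (Ω₀·levelOp·Ω₀ + (1 − Ω₀)) + P)⁻¹(p,q)‖ ≤ e^{−κ·d_n(p,q)}·n(p)n(q)∕(min(μ₀,1) − 4d|Cp|βκ)`. [folklore] -/
theorem decay_sandwich_add_firstOrder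
    (hdisj : ∀ k k' v v', cellPt S hS hdivS lvl zc k v = cellPt S hS hdivS lvl zc k' v' → k = k')
    (hcover : ∀ x : UT N, ∃ k, ∃ v : Box d (S (lvl k)), cellPt S hS hdivS lvl zc k v = x)
    (Rm : UT N × Fin d → Cp → Cp → ℝ) (hRm : ∀ b i j, ∑ k, Rm b k i * Rm b k j = if i = j then (1 : ℝ) else 0)
    (T : J → UT N → Cp → Cp → ℝ) (hT : ∀ l x i i', ∑ k, T l x k i * T l x k i' = if i = i' then (1 : ℝ) else 0)
    (a : J → ℝ) (ha : ∀ j, 0 ≤ a j) (ω : J → UT N → ℝ)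
    (hsupp : ∀ l x, ω l (ctrU N (S l) (tblk (hS l) (hdivS l) x)) ≠ 0 → ∃ k v, lvl k = l ∧ cellPt S hS hdivS lvl zc k v = x)
    {amax : ℝ} (hamax : 0 ≤ amax)
    (hscale : ∀ k, a (lvl k) * ω (lvl k) (ctrU N (S (lvl k)) (zc k)) ^ 2 * (S (lvl k) : ℝ) ^ d ≤ amax / (S (lvl k) : ℝ) ^ 2)
    (c : UT N × Fin d → ℝ) {cmax : ℝ} (hc : ∀ b, |c b| ≤ cmax) {C : ℝ}
    (hcoer : ∀ f : UT N × Cp → ℝ,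
      C * ∑ k, ((S (lvl k) : ℝ) ^ 2)⁻¹ * ∑ v : Box d (S (lvl k)), ∑ i, f (cellPt S hS hdivS lvl zc k v, i) ^ 2 ≤
        ∑ p, f p * levelOp bsrc btgt c Rm (fun l x => ctrU N (S l) (tblk (hS l) (hdivS l) x))
          (fun l x => ω l (ctrU N (S l) (tblk (hS l) (hdivS l) x))) T a f p)
    {κ : ℝ} (hκ0 : 0 ≤ κ) (hκ1 : κ ≤ 1) (hμ : 0 < C - 2 * d * cmax ^ 2 * κ ^ 2 - amax * (Real.exp (2 * d * κ) - 1))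
    (χ : UT N × Cp → ℝ) (hχ : ∀ p, χ p = 0 ∨ χ p = 1)
    (P : Matrix (UT N × Cp) (UT N × Cp) ℂ) (hP : ∀ z, 0 ≤ (star z ⬝ᵥ (P *ᵥ z)).re)
    (hPsupp : ∀ e e', P e e' ≠ 0 → e.1 = e'.1 ∨ (bondGraph (bsrc (N := N)) btgt).Adj e.1 e'.1) {β : ℝ} (hβ : 0 ≤ β)
    (hPβ : ∀ e e', e.1 ≠ e'.1 → ‖P e e'‖ ≤ β * slen (siteScale S hS hdivS lvl zc hcover) e.1 e'.1)
    (hsmall : 4 * d * (Fintype.card Cp) * β * κ < min (C - 2 * d * cmax ^ 2 * κ ^ 2 - amax * (Real.exp (2 * d * κ) - 1)) 1)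
    (p q : UT N × Cp) :
    IsUnit (cmat (mulOp χ * levelOp bsrc btgt c Rm (fun l x => ctrU N (S l) (tblk (hS l) (hdivS l) x))
          (fun l x => ω l (ctrU N (S l) (tblk (hS l) (hdivS l) x))) T a * mulOp χ + mulOp (1 - χ) :
        Module.End ℝ (UT N × Cp → ℝ)) + P) ∧
      ‖(cmat (mulOp χ * levelOp bsrc btgt c Rm (fun l x => ctrU N (S l) (tblk (hS l) (hdivS l) x))
            (fun l x => ω l (ctrU N (S l) (tblk (hS l) (hdivS l) x))) T a * mulOp χ + mulOp (1 - χ) :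
          Module.End ℝ (UT N × Cp → ℝ)) + P)⁻¹ p q‖ ≤
        Real.exp (-(κ * sdist bsrc btgt (siteScale S hS hdivS lvl zc hcover) p.1 q.1)) *
          ((siteScale S hS hdivS lvl zc hcover p.1 : ℝ) * (siteScale S hS hdivS lvl zc hcover q.1 : ℝ)) /
          (min (C - 2 * d * cmax ^ 2 * κ ^ 2 - amax * (Real.exp (2 * d * κ) - 1)) 1 - 4 * d * (Fintype.card Cp) * β * κ) := by
  classical
  set m₀ := min (C - 2 * d * cmax ^ 2 * κ ^ 2 - amax * (Real.exp (2 * d * κ) - 1)) 1 with hm₀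
  set n := siteScale S hS hdivS lvl zc hcover with hn
  have hm : 0 < m₀ := lt_min hμ zero_lt_one
  set θ : ℝ := 4 * d * (Fintype.card Cp) * β * κ / m₀ with hθdef
  have hθ : θ < 1 := by rw [hθdef, div_lt_one hm]; exact hsmall
  have hθm : θ * m₀ = 4 * d * (Fintype.card Cp) * β * κ := by rw [hθdef]; field_simp
  have hJ : ∀ q' e : UT N × Cp,
      (expRowDefect P κ (fun e => sdist bsrc btgt n e.1 q'.1) e + expColDefect P κ (fun e => sdist bsrc btgt n e.1 q'.1) e) / 2 ≤
        θ * (m₀ * ((n e.1 : ℝ) ^ 2)⁻¹) := by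
    intro q' e
    have hr := expRowDefect_le_of_bondBudget bsrc btgt n (one_le_siteScale S hS hdivS lvl zc hcover) card_adj_le_two_mul P hPsupp hβ
      hPβ hκ0 hκ1 q'.1 e
    have hc' := expColDefect_le_of_bondBudget bsrc btgt n (one_le_siteScale S hS hdivS lvl zc hcover) card_adj_le_two_mul P hPsupp hβ
      hPβ hκ0 hκ1 q'.1 e
    have e1 : θ * (m₀ * ((n e.1 : ℝ) ^ 2)⁻¹) = 2 * (Fintype.card Cp) * ((2 * d : ℕ) : ℝ) * β * κ * ((n e.1 : ℝ) ^ 2)⁻¹ := by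
      rw [← mul_assoc, hθm]; push_cast; ring
    rw [e1]
    linarith
  have h := decay_sandwich_add_complexRay S hS hdivS lvl zc hdisj hcover Rm hRm T hT a ha ω hsupp hamax hscale c hc hcoer hκ0 hκ1 hμ χ hχ
    P hP hθ hJ p q
  have e2 : (1 - θ) * m₀ = m₀ - 4 * d * (Fintype.card Cp) * β * κ := by rw [sub_mul, one_mul, hθm]
  rw [e2] at h
  exact h

end Sandwich

end Summit.QuantumFields.BalabanUV.T4Continuum.ShellMeasureDecayComplexRayDirichlet

end
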